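import Summits.CriticalPhenomena.PercolationContinuityZ3.Theorems.PercNearOneGluingNoHeavyLowerTailCSHDefs
import Literature.Probability.Percolation.TwoSetConditionalAssociation
import Literature.Probability.Percolation.KozmaNitzanSeparatingTriple
import HarnessLib

/-!
# Single-edge extremality holds against every competitor supported on `{v ∈ C_x}` (PAPER-2 track (ii): constants of the CSH family)

builds on p205010 (kernel theorem, internal audit signed; external expert review pending).  Support file (`--supports
stmt-CriticalPhenomena-4575`), seat `prim-consts-2`; rows A6/A11 of `run/shared/lean/prim/consts/CONSTANTS.md`, prim-paper-s3 F7.  No definitions,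
no named facts, no sorries.

Level `0` of the conditioned slack hierarchy (MDL(X)): `covD w x Y f o ≥ λ · covD w x Y f v` for monotone `f` of the open edge cluster `𝐂_x`
(`covD` = `CSH.covD`, the denominator-free covariance under `D = {x ↮ Y}`).  The single-pair functional `1{s(x,v) ∈ 𝐂_x}` caps the admissible
`λ` at `p⋆ = [P(o ∈ C_x ∪ C_v | x ↮ Y, v ↮ Y) − P(o ∈ C_x | x ↮ Y)] / P(v ∉ C_x | x ↮ Y)` (`Consts.singleEdge_not_improvable`), and the census
(n ≤ 6, 2 772 level-0 placements) finds `p⋆` admissible every time ("single-edge extremality", OPEN).  This file proves the conjecture for the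
natural class of competitors:

* `Consts.singleEdge_margin_nonneg_of_support` — **THEOREM.**  For every finite weighted graph, every owner `x`, avoided set `Y`, observers `o, v`,
  and every monotone `f` SUPPORTED ON `{v ∈ V(𝐂_x)}` (i.e. `f(C) = 0` whenever no pair of `C` contains `v` — all functionals "through `v`":
  `1{s(x,v) open}`, `1{x–u–v open}`, `1{T internally connected}` with `v ∈ T`, …), the level-0 margin at `λ = p⋆` is nonnegative, denominator-free:
  `covD(f, v) · [μ(D) μ(D₁ ∩ O) − μ(D₁) μ(D ∩ {x ↔ o})] ≤ covD(f, o) · [μ(D₁) μ(D ∩ {x ↮ v})]`,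
  `D₁ = {x ↮ Y} ∩ {v ↮ Y}`, `O = {x ↔ o} ∪ {v ↔ o}`.  Equivalently: for every increasing event `U ⊆ {v ∈ C_x}` of the cluster,
  `P(o ∈ C_x | U, x ↮ Y) ≥ P(o ∈ C_x ∪ C_v | x ↮ Y, v ↮ Y)` — among the increasing events forcing `v` into the cluster of `x`, the single
  open pair `s(x,v)` is the one least favourable to `o`.
  Proof: on the support of `f` the cluster of `x` is the cluster of the SET `{x, v}` and `{x ↔ o} = O`; van den Berg–Häggström–Kahn's
  Theorem 1.3 with vertex sets (`BHK2006_setClusterConditionalPositiveAssociation`, source set `{x,v}`, avoided set `Y`) gives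
  `μ(D₁) ∫_{D₁∩O} f ≥ (∫_{D₁} f) μ(D₁ ∩ O)`, and the margin factors as `μ(D ∩ {x ↮ v}) · μ(D) · [that bracket]`.
[cite: VandenbergHaggstromKahn2005, Thm. 1.3 (p. 6) with Remark 1 after Thm. 1.2 (p. 5); KozmaNitzan2024 §2.2 p. 5 ("Theorem (BHK)")]
-/

noncomputable section

namespace Summit.CriticalPhenomena.PercolationContinuityZ3.Theorems

open MeasureTheory Set Literature.Probability.LatticeModels Literature.Probability.Percolation
open scoped Classical

namespace Consts

variable {V : Type*} [Fintype V]

omit [Fintype V] in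
/-- If `x ↔ v` then the open edge cluster of `v` is contained in that of `x`. [folklore] -/
theorem openEdgeCluster_subset_of_reachable {ω : BondConfig V} {x v : V} (h : (openGraph ω).Reachable x v) :
    openEdgeCluster ω v ⊆ openEdgeCluster ω x := by
  intro d hd
  rw [mem_openEdgeCluster_iff] at hd ⊢
  exact ⟨hd.1, hd.2.1, fun u hu => h.trans (hd.2.2 u hu)⟩

omit [Fintype V] in
/-- The cluster of the set `{x, v}` is the cluster of `x` when `x ↔ v`. [folklore] -/
theorem biUnion_pair_openEdgeCluster_eq_of_reachable {ω : BondConfig V} {x v : V} (h : (openGraph ω).Reachable x v) :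
    (⋃ s ∈ ({x, v} : Set V), openEdgeCluster ω s) = openEdgeCluster ω x := by
  ext d
  simp only [mem_iUnion, mem_insert_iff, mem_singleton_iff, exists_prop]
  constructor
  · rintro ⟨s, hs | hs, hd⟩
    · exact hs ▸ hd
    · subst hs; exact openEdgeCluster_subset_of_reachable h hd
  · intro hd
    exact ⟨x, Or.inl rfl, hd⟩

omit [Fintype V] in
/-- A functional supported on `{v ∈ V(𝐂_x)}` vanishes unless `x ↔ v`. [folklore] -/
theorem apply_openEdgeCluster_eq_zero_of_not_reachable {ω : BondConfig V} {x v : V} (f : Set (Sym2 V) → ℝ)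
    (hfv : ∀ C : Set (Sym2 V), (∀ d ∈ C, v ∉ d) → f C = 0) (h : ¬ (openGraph ω).Reachable x v) :
    f (openEdgeCluster ω x) = 0 := by
  refine hfv _ fun d hd hvd => h ?_
  rw [mem_openEdgeCluster_iff] at hd
  exact hd.2.2 v hvd

/-- **THEOREM (single-edge extremality against competitors through `v`).**  For every finite weighted graph (`μ = prodBernoulli w`), owner
`x`, avoided set `Y`, observers `o, v`, and every monotone functional `f` of the open edge cluster of `x` that vanishes on clusters not
containing `v` (`f(C) = 0` if no pair of `C` contains `v`): with `D = {x ↮ Y}`, `D₁ = {x ↮ Y} ∩ {v ↮ Y}`, `O = {x ↔ o} ∪ {v ↔ o}`,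
`covD(f, v) · [μ(D) μ(D₁ ∩ O) − μ(D₁) μ(D ∩ {x ↔ o})] ≤ covD(f, o) · [μ(D₁) μ(D ∩ {x ↮ v})]` — the level-0 margin of the conditioned slack
hierarchy at the single-pair value `p⋆` is nonnegative at `f` (cf. `Consts.singleEdge_not_improvable`: no constant above `p⋆` is admissible).
[cite: VandenbergHaggstromKahn2005, Thm. 1.3 (p. 6) with Remark 1 after Thm. 1.2 (p. 5)] -/
theorem singleEdge_margin_nonneg_of_support (w : Sym2 V → unitInterval) (x o v : V) (Y : Set V) (f : Set (Sym2 V) → ℝ)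
    (hf : Monotone f) (hfv : ∀ C : Set (Sym2 V), (∀ d ∈ C, v ∉ d) → f C = 0) :
    CSH.covD w x Y f v *
        ((prodBernoulli w).real {ω : BondConfig V | ∀ y ∈ Y, ¬ (openGraph ω).Reachable x y} *
            (prodBernoulli w).real
              ({ω : BondConfig V | ∀ y ∈ Y, ¬ (openGraph ω).Reachable x y ∧ ¬ (openGraph ω).Reachable v y} ∩
                (openConn x o ∪ openConn v o)) -
          (prodBernoulli w).real
              {ω : BondConfig V | ∀ y ∈ Y, ¬ (openGraph ω).Reachable x y ∧ ¬ (openGraph ω).Reachable v y} *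
            (prodBernoulli w).real ({ω : BondConfig V | ∀ y ∈ Y, ¬ (openGraph ω).Reachable x y} ∩ openConn x o)) ≤
      CSH.covD w x Y f o *
        ((prodBernoulli w).real
            {ω : BondConfig V | ∀ y ∈ Y, ¬ (openGraph ω).Reachable x y ∧ ¬ (openGraph ω).Reachable v y} *
          (prodBernoulli w).real
            ({ω : BondConfig V | ∀ y ∈ Y, ¬ (openGraph ω).Reachable x y} ∩ {ω | ¬ (openGraph ω).Reachable x v})) := by
  classical
  set μ := prodBernoulli w with hμ
  have hmeas : ∀ U : Set (BondConfig V), MeasurableSet U := fun _ => MeasurableSet.of_discrete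
  set D : Set (BondConfig V) := {ω | ∀ y ∈ Y, ¬ (openGraph ω).Reachable x y} with hD
  set D₁ : Set (BondConfig V) := {ω | ∀ y ∈ Y, ¬ (openGraph ω).Reachable x y ∧ ¬ (openGraph ω).Reachable v y} with hD₁
  set O : Set (BondConfig V) := openConn x o ∪ openConn v o with hO
  set N : Set (BondConfig V) := {ω | ¬ (openGraph ω).Reachable x v} with hN
  set g : BondConfig V → ℝ := fun ω => f (openEdgeCluster ω x) with hg
  -- support: `g ω ≠ 0 ⇒ x ↔ v`
  have hg0 : ∀ ω : BondConfig V, ¬ (openGraph ω).Reachable x v → g ω = 0 := fun ω h =>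
    apply_openEdgeCluster_eq_zero_of_not_reachable f hfv h
  -- (1) `∫_{D ∩ {x ↔ v}} g = ∫_D g = ∫_{D₁} g` and `∫_{D ∩ {x ↔ o}} g = ∫_{D₁ ∩ O} g`
  have hint_eq : ∀ S T : Set (BondConfig V), (∀ ω, (openGraph ω).Reachable x v → (ω ∈ S ↔ ω ∈ T)) →
      ∫ ω in S, g ω ∂μ = ∫ ω in T, g ω ∂μ := by
    intro S T hST
    rw [← integral_indicator (hmeas S), ← integral_indicator (hmeas T)]
    refine integral_congr_ae (Filter.Eventually.of_forall fun ω => ?_)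
    by_cases hr : (openGraph ω).Reachable x v
    · by_cases hS : ω ∈ S
      · rw [indicator_of_mem hS, indicator_of_mem ((hST ω hr).1 hS)]
      · rw [indicator_of_notMem hS, indicator_of_notMem (fun h => hS ((hST ω hr).2 h))]
    · have h0 : g ω = 0 := hg0 ω hr
      by_cases hS : ω ∈ S
      · rw [indicator_of_mem hS, h0]
        by_cases hT : ω ∈ T
        · rw [indicator_of_mem hT, h0]
        · rw [indicator_of_notMem hT]
      · rw [indicator_of_notMem hS]
        by_cases hT : ω ∈ T
        · rw [indicator_of_mem hT, h0]
        · rw [indicator_of_notMem hT]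
  have i1 : ∫ ω in D ∩ openConn x v, g ω ∂μ = ∫ ω in D, g ω ∂μ :=
    hint_eq _ _ (fun ω hr => by rw [mem_inter_iff]; exact ⟨fun h => h.1, fun h => ⟨h, hr⟩⟩)
  have i2 : ∫ ω in D, g ω ∂μ = ∫ ω in D₁, g ω ∂μ := by
    refine hint_eq _ _ (fun ω hr => ?_)
    simp only [hD, hD₁, mem_setOf_eq]
    exact ⟨fun h y hy => ⟨h y hy, fun hvy => h y hy (hr.trans hvy)⟩, fun h y hy => (h y hy).1⟩
  have i3 : ∫ ω in D ∩ openConn x o, g ω ∂μ = ∫ ω in D₁ ∩ O, g ω ∂μ := by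
    refine hint_eq _ _ (fun ω hr => ?_)
    simp only [hD, hD₁, hO, mem_inter_iff, mem_setOf_eq, mem_union]
    constructor
    · rintro ⟨h, hxo⟩
      exact ⟨fun y hy => ⟨h y hy, fun hvy => h y hy (hr.trans hvy)⟩, Or.inl hxo⟩
    · rintro ⟨h, hxo | hvo⟩
      · exact ⟨fun y hy => (h y hy).1, hxo⟩
      · exact ⟨fun y hy => (h y hy).1, show (openGraph ω).Reachable x o from hr.trans hvo⟩
  -- (2) `μ(D ∩ {x ↔ v}) + μ(D ∩ N) = μ(D)`
  have mDN : μ.real (D ∩ openConn x v) + μ.real (D ∩ N) = μ.real D := by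
    have h := measureReal_inter_add_sdiff (μ := μ) (s := D) (hmeas (openConn x v))
    have hset : D \ openConn x v = D ∩ N := by
      ext ω; simp only [mem_sdiff, mem_inter_iff, hN, mem_setOf_eq]; rfl
    rwa [hset] at h
  -- (3) vdBHK Thm 1.3 for the source set `{x, v}` avoiding `Y`: `(∫_{D₁} g)(μ(D₁ ∩ O)) ≤ μ(D₁) ∫_{D₁∩O} g`
  set F : Set (Sym2 V) → ℝ := fun K => if (openGraph K).Reachable x v then f K else 0 with hF
  set G : Set (Sym2 V) → ℝ := fun K => if ((openGraph K).Reachable x o ∨ (openGraph K).Reachable v o) then (1 : ℝ) else 0 with hG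
  have hf0 : ∀ C, 0 ≤ f C := fun C => by
    have h := hfv ∅ (fun d hd => absurd hd (Set.notMem_empty d))
    rw [← h]; exact hf (Set.empty_subset C)
  have hFm : Monotone F := by
    intro K K' hKK'
    simp only [hF]
    by_cases h : (openGraph K).Reachable x v
    · rw [if_pos h, if_pos (h.mono (openGraph_mono hKK'))]; exact hf hKK'
    · rw [if_neg h]; split_ifs
      · exact hf0 K'
      · exact le_rfl
  have hGm : Monotone G := by
    refine TripodExchange.predIndicator_monotone ?_
    rintro K K' hKK' (h | h)
    · exact Or.inl (h.mono (openGraph_mono hKK'))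
    · exact Or.inr (h.mono (openGraph_mono hKK'))
  have hxS : x ∈ ({x, v} : Set V) := mem_insert x {v}
  have hvS : v ∈ ({x, v} : Set V) := mem_insert_of_mem x rfl
  have hFω : ∀ ω : BondConfig V, F (⋃ s ∈ ({x, v} : Set V), openEdgeCluster ω s) = g ω := by
    intro ω
    simp only [hF, hg]
    by_cases hr : (openGraph ω).Reachable x v
    · rw [if_pos ((KNSep.reachable_iff_cluster ω {x, v} hxS v).1 hr), biUnion_pair_openEdgeCluster_eq_of_reachable hr]
    · rw [if_neg (fun h => hr ((KNSep.reachable_iff_cluster ω {x, v} hxS v).2 h))]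
      exact (apply_openEdgeCluster_eq_zero_of_not_reachable f hfv hr).symm
  have hGω : ∀ ω : BondConfig V, G (⋃ s ∈ ({x, v} : Set V), openEdgeCluster ω s) = O.indicator 1 ω := by
    intro ω
    have hiff : ((openGraph (⋃ s ∈ ({x, v} : Set V), openEdgeCluster ω s)).Reachable x o ∨
        (openGraph (⋃ s ∈ ({x, v} : Set V), openEdgeCluster ω s)).Reachable v o) ↔
        ((openGraph ω).Reachable x o ∨ (openGraph ω).Reachable v o) := by
      rw [← KNSep.reachable_iff_cluster ω {x, v} hxS o, ← KNSep.reachable_iff_cluster ω {x, v} hvS o]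
    simp only [hG, hiff]
    exact TwoSetConditionalAssociation.predIndicator_eq_indicator (fun ω' => (openGraph ω').Reachable x o ∨ (openGraph ω').Reachable v o) ω
  have hDS : {ω : BondConfig V | ∀ s ∈ ({x, v} : Set V), ∀ t ∈ Y, ¬ (openGraph ω).Reachable s t} = D₁ := by
    ext ω
    simp only [hD₁, mem_setOf_eq, mem_insert_iff, mem_singleton_iff, forall_eq_or_imp, forall_eq]
    exact ⟨fun h y hy => ⟨h.1 y hy, h.2 y hy⟩, fun h => ⟨fun y hy => (h y hy).1, fun y hy => (h y hy).2⟩⟩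
  have key := BHK2006_setClusterConditionalPositiveAssociation w {x, v} Y F G hFm hGm
  simp only [hDS, hFω, hGω] at key
  have e1 : ∫ ω in D₁, O.indicator (1 : BondConfig V → ℝ) ω ∂μ = μ.real (D₁ ∩ O) := KNPreFKG.setIntegral_indicator_one_eq μ D₁ O
  have e2 : ∫ ω in D₁, g ω * O.indicator (1 : BondConfig V → ℝ) ω ∂μ = ∫ ω in D₁ ∩ O, g ω ∂μ := by
    have hfun : (fun ω : BondConfig V => g ω * O.indicator (1 : BondConfig V → ℝ) ω) = O.indicator g := by
      funext ω
      rw [← Set.indicator_mul_right O g (1 : BondConfig V → ℝ)]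
      simp only [Pi.one_apply, mul_one]
    rw [hfun, setIntegral_indicator (hmeas O)]
  rw [e1, e2] at key
  -- key : (∫_{D₁} g) * μ(D₁ ∩ O) ≤ μ(D₁) * ∫_{D₁∩O} g
  -- (4) assemble
  unfold CSH.covD
  rw [i1, i3, i2]
  set J : ℝ := ∫ ω in D₁, g ω ∂μ with hJ
  set I : ℝ := ∫ ω in D₁ ∩ O, g ω ∂μ with hI
  have hNn : 0 ≤ μ.real (D ∩ N) := measureReal_nonneg
  have hDn : 0 ≤ μ.real D := measureReal_nonneg
  have hid : (μ.real D * I - J * μ.real (D ∩ openConn x o)) * (μ.real D₁ * μ.real (D ∩ N)) -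
      (μ.real D * J - J * μ.real (D ∩ openConn x v)) *
        (μ.real D * μ.real (D₁ ∩ O) - μ.real D₁ * μ.real (D ∩ openConn x o)) =
      μ.real (D ∩ N) * μ.real D * (μ.real D₁ * I - J * μ.real (D₁ ∩ O)) := by
    have hB : μ.real (D ∩ openConn x v) = μ.real D - μ.real (D ∩ N) := by linarith
    rw [hB]; ring
  have hpos : 0 ≤ μ.real (D ∩ N) * μ.real D * (μ.real D₁ * I - J * μ.real (D₁ ∩ O)) :=
    mul_nonneg (mul_nonneg hNn hDn) (by linarith)
  linarith [hid, hpos]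

end Consts

end Summit.CriticalPhenomena.PercolationContinuityZ3.Theorems

end
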